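import Summits.Langlands.Langlands.Theses.OrdinaryPrimeTransport
import Literature.NumberTheory.Automorphic.WeaklyRegularGaloisRep
import Literature.NumberTheory.Automorphic.QuadraticBaseChangeFrobCompatibleProofs
import Literature.NumberTheory.Automorphic.AutomorphicRepsGLSatakeFlathProofs
import HarnessLib

/-!
# F3 `_special` — the floor `m = 2` IS the family member (line `MultiplicityThreePolarizableSatakeA`, crux
`ReciprocityUpToIrreducibility`, item stmt-Langlands-14328; G4 ladder-down generation 33)

`floor_two : FakhruddinPilloni2021_galoisRep_of_weaklyRegular_odd → PolarizableMultiplicitySatakeA 2` — ONE `obtain`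
on the in-tree named fact (Fakhruddin–Pilloni Thm. 9.10: its hypotheses verbatim; its conclusion at every unramified
`v ∤ ℓ` gives ours at almost every one) and the special-value `example … := by simpa using floor_two h`; also
`antitone` and `of_le_two` (every cell `m ≤ 2`).  Sorry-free.  Definitions verbatim from
`Lines/MultiplicityThreePolarizableSatakeA.lean` §1.
-/

noncomputable section

set_option linter.dupNamespace false

open scoped MatrixGroups Matrix NumberField Polynomial Classical
open Filter IsDedekindDomain Field Polynomial NumberField
open Literature.NumberTheory.Automorphic Literature.NumberTheory.GaloisRepresentations
open Literature.NumberTheory.PAdicHodge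
open Summit.Langlands

namespace Summit.Langlands.Langlands.Cruxes.ReciprocityUpToIrreducibility.MultiplicityThreePolarizableSatakeA

/-! ## 1. The graded family and the rung -/

/-- **Clause (A), a.e.-Satake form, C-normalisation, for odd polarizable `π` over CM fields whose archimedean
exponents have multiplicity `≤ m`.**  For `K` CM, `π` cuspidal on `GL_n(𝔸_K)` (`n ≥ 1`) with a C-algebraic
infinity type `T` such that at every complex embedding every exponent `λ_{i,σ}` of the infinitesimal character
occurs with multiplicity `≤ m` (for `m ≤ 2` phrased as Fakhruddin–Pilloni's *weak regularity*), `π^c ≅ π^∨`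
(`IsEssConjSelfDual π 1`) and `π` odd (Asai sign `+1`): for every `ℓ`, `ι : ℚ̄_ℓ ≃ ℂ` there is a continuous
`r : Γ_K → GL_n(ℚ̄_ℓ)` which at almost every finite place `v ∤ ℓ` where `π_v` has Satake parameter `α` is
unramified with `charpoly r(Frob_v) = arithFrobPolyOfSatake ι q_v n α` (the formula of Fakhruddin–Pilloni
Thm. 9.10 / HLTT Thm. A verbatim). [cite: FakhruddinPilloni2021, Thm. 9.10] [cite: Goldring2016, §4.4.1] -/
def PolarizableMultiplicitySatakeA (m : ℕ) : Prop :=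
  ∀ (n : ℕ) (K : Type) [Field K] [NumberField K] [IsCMField K]
    (hcpt : isCompact_glFiniteIntegralLevel n K) (π : CuspidalAutomorphicRepData n K hcpt)
    (T : InfinityType K n), 0 < n → π.1.HasInfinityType T → T.IsCAlgebraic →
      (m ≤ 2 → T.IsWeaklyRegular) →
      (∀ (σ : K →+* ℂ) (a : ℂ), ((T σ).map ArchWeight.a).count a ≤ m) →
      π.1.IsEssConjSelfDual 1 → π.1.HasAsaiSign (NumberField.IsCMField.complexConj K) 1 →
        ∀ (ℓ : ℕ) [Fact ℓ.Prime] (ι : PadicAlgCl ℓ ≃+* ℂ),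
          ∃ r : FramedGaloisRep K (PadicAlgCl ℓ) n,
            ∀ᶠ v : HeightOneSpectrum (𝓞 K) in cofinite, ∀ α : Multiset ℂ, π.1.HasSatakeParamAt v α →
              ((ℓ : ℕ) : 𝓞 K) ∉ v.asIdeal →
                r.IsUnramifiedAt v ∧ r.HasFrobCharpolyAt v (arithFrobPolyOfSatake ι v.residueCard n α)

/-- **THE RUNG** (`m = 3`): the first cell past weak regularity. -/
def MultiplicityThreePolarizableSatakeA : Prop := PolarizableMultiplicitySatakeA 3

/-! ## 2. Monotonicity and the floor -/

/-- The family is antitone in `m` (larger `m` admits more `π`). -/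
theorem antitone {m m' : ℕ} (hmm' : m ≤ m') (h : PolarizableMultiplicitySatakeA m') :
    PolarizableMultiplicitySatakeA m := by
  intro n K _ _ _ hcpt π T hn hT hC hW hmult hsd hodd ℓ _ ι
  exact h n K hcpt π T hn hT hC (fun h2 => hW (hmm'.trans h2))
    (fun σ a => (hmult σ a).trans hmm') hsd hodd ℓ ι

/-- **Floor** `m = 2` from Fakhruddin–Pilloni Thm. 9.10 (the in-tree named fact; verbatim hypotheses, its
conclusion at every unramified `v ∤ ℓ` implies ours at almost every one). [cite: FakhruddinPilloni2021, Thm. 9.10] -/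
theorem floor_two (h : FakhruddinPilloni2021_galoisRep_of_weaklyRegular_odd) :
    PolarizableMultiplicitySatakeA 2 := by
  intro n K _ _ _ hcpt π T _hn hT hC hW _hmult hsd hodd ℓ _ ι
  obtain ⟨r, hr⟩ := h n K hcpt π T hT hC (hW le_rfl) hsd hodd ℓ ι
  exact ⟨r, Eventually.of_forall hr⟩

/-- Every cell `m ≤ 2` from the floor. -/
theorem of_le_two {m : ℕ} (hm : m ≤ 2) (h : FakhruddinPilloni2021_galoisRep_of_weaklyRegular_odd) :
    PolarizableMultiplicitySatakeA m :=
  antitone hm (floor_two h)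

/-- **F3 special-value check**: the floor cell IS the floor fact (one `simpa`). -/
example (h : FakhruddinPilloni2021_galoisRep_of_weaklyRegular_odd) : PolarizableMultiplicitySatakeA 2 := by
  simpa using floor_two h

end Summit.Langlands.Langlands.Cruxes.ReciprocityUpToIrreducibility.MultiplicityThreePolarizableSatakeA

end
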